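import Mathlib.Algebra.MvPolynomial.PDeriv
import Mathlib.LinearAlgebra.Matrix.Determinant.Basic
import Mathlib.RingTheory.Extension.Presentation.Basic
import HarnessLib

/-!
# Elementary standard and strictly standard elements (Elkik; Stacks 07C7)

Topic: `Literature/AlgebraicGeometry/Resolution`. The Stacks Project, *Smoothing Ring Maps*
(Tag 07BW), Definition 07C7 (= Def. 16.2.3), the notion on which the lifting lemma 07CP, the
desingularization lemmas 07CR/07CT and Lemma 07F4 of the proof of Popescu's theorem
(`Popescu1986_generalNeronDesingularization`, via `Stacks07F5_reduceToField` and
`Stacks07FE_resolveSpecial`, `NeronPopescuSteps.lean`) are built: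

> **Definition 07C7.** Let `R → A` be a ring map of finite presentation. We say an element
> `a ∈ A` is *elementary standard in `A` over `R`* if there exists a presentation
> `A = R[x_1, …, x_n]/(f_1, …, f_m)` and `0 ≤ c ≤ min(n, m)` such that
> (16.2.3.1) `a = a' det(∂f_j/∂x_i)_{i,j = 1, …, c}` for some `a' ∈ A`, and
> (16.2.3.2) `a f_{c+j} ∈ (f_1, …, f_c) + (f_1, …, f_m)²` for `j = 1, …, m - c`.
> We say `a ∈ A` is *strictly standard in `A` over `R`* if there exists a presentation
> `A = R[x_1, …, x_n]/(f_1, …, f_m)` and `0 ≤ c ≤ min(n, m)` such that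
> (16.2.3.3) `a = ∑_{I ⊂ {1, …, n}, |I| = c} a_I det(∂f_j/∂x_i)_{j = 1, …, c, i ∈ I}` for some
> `a_I ∈ A`, and
> (16.2.3.4) `a f_{c+j} ∈ (f_1, …, f_c) + (f_1, …, f_m)²` for `j = 1, …, m - c`.

This file DEFINES these notions on top of Mathlib's presentations
`Algebra.Presentation R A (Fin n) (Fin m)` (generators `P.val : Fin n → A`, the surjection
`aeval P.val : R[x_1, …, x_n] → A`, relations `P.relation : Fin m → R[x_1, …, x_n]` spanning
the kernel `P.ker`) and proves their first properties:

* `jacobianMinor f hc ι = det(∂f_j/∂x_{ι(i)})_{i, j ≤ c}` — the `c × c` Jacobian minor of the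
  first `c` relations of `f = (f_1, …, f_m)` with respect to `c` chosen variables;
* `LiftCond P a c hc` — conditions (16.2.3.2) = (16.2.3.4) for a presentation `P`;
* `IsElementaryStandard R a`, `IsStrictlyStandard R a` — Definition 07C7;
* `IsElementaryStandard.isStrictlyStandard` ("elementary standard, hence strictly standard",
  proof of 07F5), `liftCond_of_exists` ((16.2.3.2) may be checked on one lift),
  `IsElementaryStandard.finitePresentation`.

## Rendering notes

* "The first `c`" relations/variables are `Fin.castLE`. Condition (16.2.3.2) is stated for
  every lift `p ∈ R[x_1, …, x_n]` of `a` (equivalent to "for some lift", `liftCond_of_exists`,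
  since two lifts differ by an element of `P.ker = (f_1, …, f_m)`).
* In (16.2.3.3) Stacks sums over the `c`-element subsets `I ⊆ {1, …, n}` (with `i ∈ I` in
  increasing order). We sum over all maps `ι : Fin c → Fin n` with coefficients `a_ι ∈ A`:
  this describes the same elements `a`, because the minor attached to a non-injective `ι`
  vanishes (`jacobianMinor_eq_zero_of_not_injective`) and the minor attached to an injective
  `ι` is `±` the minor of its image subset. This avoids enumerating finite subsets.
* `0 ≤ c ≤ min(n, m)` is `c ≤ n ∧ c ≤ m`. The existence of a finite presentation
  (`Algebra.Presentation.exists_presentation_fin`) is Mathlib's.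

## Sources

* The Stacks Project, *Smoothing Ring Maps* (Tag 07BW), Definition 07C7 (Def. 16.2.3) with
  equations (16.2.3.1)–(16.2.3.4); Lemmas 07C9, 07CA (Elkik), 07F4, and the sentence "we may
  assume that `π` is elementary standard, hence strictly standard in `A`" of the proof of
  Lemma 07F5. [StacksProject]
* R. Elkik, *Solutions d'équations à coefficients dans un anneau hensélien*, Ann. Sci. ÉNS 6
  (1973), §0.2 (the ideal `H_B` and standard elements). [cited through StacksProject]
-/

noncomputable section

open MvPolynomial

namespace Literature.AlgebraicGeometry.Resolution

universe u

/-! ## Jacobian minors -/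

section Minor

variable {R : Type u} [CommRing R]

/-- The **Jacobian minor** `det(∂f_j/∂x_{ι(i)})_{i, j = 1, …, c}` of the first `c` relations
`f_1, …, f_c` of an ordered family `f = (f_1, …, f_m)` with respect to the variables
`x_{ι(1)}, …, x_{ι(c)}` (Stacks 07C7, equations (16.2.3.1), (16.2.3.3)).
[cite: StacksProject, Tag 07C7] -/
def jacobianMinor {n m : ℕ} (f : Fin m → MvPolynomial (Fin n) R) {c : ℕ} (hc : c ≤ m)
    (ι : Fin c → Fin n) : MvPolynomial (Fin n) R :=
  (Matrix.of fun i j : Fin c => pderiv (ι i) (f (Fin.castLE hc j))).det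

/-- The Jacobian minor with respect to a non-injective choice of variables vanishes (two equal
rows). [folklore] -/
theorem jacobianMinor_eq_zero_of_not_injective {n m : ℕ} (f : Fin m → MvPolynomial (Fin n) R)
    {c : ℕ} (hc : c ≤ m) {ι : Fin c → Fin n} (hι : ¬ Function.Injective ι) :
    jacobianMinor f hc ι = 0 := by
  rw [Function.Injective] at hι
  push Not at hι
  obtain ⟨i, i', hii', hne⟩ := hι
  exact Matrix.det_zero_of_row_eq hne (funext fun j => by simp [Matrix.of_apply, hii'])

end Minor

/-! ## Conditions (16.2.3.2) = (16.2.3.4) for a presentation -/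

section LiftCond

variable {R A : Type u} [CommRing R] [CommRing A] [Algebra R A] {n m : ℕ}
  (P : Algebra.Presentation R A (Fin n) (Fin m))

/-- Two lifts of the same element along `aeval P.val : R[x_1, …, x_n] → A` differ by an element
of `P.ker = (f_1, …, f_m)`. [folklore] -/
theorem sub_mem_ker_of_aeval_eq {p q : P.Ring} (h : aeval P.val p = aeval P.val q) :
    p - q ∈ P.ker := by
  rw [P.ker_eq_ker_aeval_val, RingHom.mem_ker, map_sub, h, sub_self]

/-- **Conditions (16.2.3.2) = (16.2.3.4) of Stacks 07C7** for the presentation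
`A = R[x_1, …, x_n]/(f_1, …, f_m)` given by `P`: `a f_{c+j} ∈ (f_1, …, f_c) + (f_1, …, f_m)²`
for `j = 1, …, m - c`, for (every) lift of `a ∈ A` to `R[x_1, …, x_n]`.
[cite: StacksProject, Tag 07C7] -/
def LiftCond (a : A) (c : ℕ) (hc : c ≤ m) : Prop :=
  ∀ p : P.Ring, aeval P.val p = a → ∀ j : Fin m, c ≤ (j : ℕ) →
    p * P.relation j ∈ Ideal.span (Set.range (P.relation ∘ Fin.castLE hc)) ⊔ P.ker ^ 2

variable {P}

/-- It suffices to check (16.2.3.2) for one lift of `a`. [cite: StacksProject, Tag 07C7] -/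
theorem liftCond_of_exists {a : A} {c : ℕ} {hc : c ≤ m} (p₀ : P.Ring) (hp₀ : aeval P.val p₀ = a)
    (h : ∀ j : Fin m, c ≤ (j : ℕ) →
      p₀ * P.relation j ∈ Ideal.span (Set.range (P.relation ∘ Fin.castLE hc)) ⊔ P.ker ^ 2) :
    LiftCond P a c hc := by
  intro p hp j hj
  have hpp : p * P.relation j = p₀ * P.relation j + (p - p₀) * P.relation j := by ring
  rw [hpp]
  refine Ideal.add_mem _ (h j hj) (Ideal.mem_sup_right ?_)
  rw [pow_two]
  exact Ideal.mul_mem_mul (sub_mem_ker_of_aeval_eq P (hp.trans hp₀.symm)) (P.relation_mem_ker j)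

/-- For `j ≤ c` the membership of (16.2.3.2) holds trivially (`f_j ∈ (f_1, …, f_c)`), so the
condition gives the membership for all `j`. [folklore] -/
theorem LiftCond.mem {a : A} {c : ℕ} {hc : c ≤ m} (h : LiftCond P a c hc) (p : P.Ring)
    (hp : aeval P.val p = a) (j : Fin m) :
    p * P.relation j ∈ Ideal.span (Set.range (P.relation ∘ Fin.castLE hc)) ⊔ P.ker ^ 2 := by
  by_cases hj : c ≤ (j : ℕ)
  · exact h p hp j hj
  · refine Ideal.mem_sup_left (Ideal.mul_mem_left _ _ (Ideal.subset_span ?_))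
    refine ⟨⟨j, lt_of_not_ge hj⟩, ?_⟩
    simp [Fin.castLE]

end LiftCond

/-! ## Definition 07C7 -/

section Definitions

variable (R : Type u) {A : Type u} [CommRing R] [CommRing A] [Algebra R A]

/-- **Stacks, Definition 07C7 (elementary standard element).** `a ∈ A` is *elementary standard
in `A` over `R`* if there is a presentation `A = R[x_1, …, x_n]/(f_1, …, f_m)` and
`0 ≤ c ≤ min(n, m)` such that `a = a' det(∂f_j/∂x_i)_{i,j = 1, …, c}` for some `a' ∈ A`
(16.2.3.1) and `a f_{c+j} ∈ (f_1, …, f_c) + (f_1, …, f_m)²` for `j = 1, …, m - c` (16.2.3.2).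
(`A` is then of finite presentation over `R`.) [cite: StacksProject, Tag 07C7] -/
def IsElementaryStandard (a : A) : Prop :=
  ∃ (n m : ℕ) (P : Algebra.Presentation R A (Fin n) (Fin m)) (c : ℕ) (hcn : c ≤ n)
    (hcm : c ≤ m),
    (∃ a' : A, a = a' * aeval P.val (jacobianMinor P.relation hcm (Fin.castLE hcn))) ∧
      LiftCond P a c hcm

/-- **Stacks, Definition 07C7 (strictly standard element).** `a ∈ A` is *strictly standard in
`A` over `R`* if there is a presentation `A = R[x_1, …, x_n]/(f_1, …, f_m)` and
`0 ≤ c ≤ min(n, m)` such that `a = ∑_I a_I det(∂f_j/∂x_i)_{j = 1, …, c, i ∈ I}`, the sum over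
the `c`-element subsets `I ⊆ {1, …, n}`, for some `a_I ∈ A` (16.2.3.3) — equivalently (see
the module docstring) `a = ∑_ι a_ι det(∂f_j/∂x_{ι(i)})_{i, j ≤ c}` over all
`ι : {1, …, c} → {1, …, n}` — and `a f_{c+j} ∈ (f_1, …, f_c) + (f_1, …, f_m)²` for
`j = 1, …, m - c` (16.2.3.4). [cite: StacksProject, Tag 07C7] -/
def IsStrictlyStandard (a : A) : Prop :=
  ∃ (n m : ℕ) (P : Algebra.Presentation R A (Fin n) (Fin m)) (c : ℕ) (_ : c ≤ n)
    (hcm : c ≤ m),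
    (∃ coef : (Fin c → Fin n) → A,
      a = ∑ ι, coef ι * aeval P.val (jacobianMinor P.relation hcm ι)) ∧ LiftCond P a c hcm

variable {R}

/-- **An elementary standard element is strictly standard** (Stacks, proof of 07F5: "we may
assume that `π` is elementary standard, hence strictly standard in `A`"): take `a_I = a'` for
`I = {1, …, c}` and `a_I = 0` otherwise. [cite: StacksProject, Tag 07C7] -/
theorem IsElementaryStandard.isStrictlyStandard {a : A} (h : IsElementaryStandard R a) :
    IsStrictlyStandard R a := by
  classical
  obtain ⟨n, m, P, c, hcn, hcm, ⟨a', ha⟩, hcond⟩ := h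
  refine ⟨n, m, P, c, hcn, hcm, ⟨fun ι => if ι = Fin.castLE hcn then a' else 0, ?_⟩, hcond⟩
  rw [Finset.sum_eq_single (Fin.castLE hcn)]
  · simpa using ha
  · intro ι _ hι
    simp [hι]
  · intro hnot
    exact absurd (Finset.mem_univ _) hnot

/-- An elementary standard element lives in a finitely presented algebra. [folklore] -/
theorem IsElementaryStandard.finitePresentation {a : A} (h : IsElementaryStandard R a) :
    Algebra.FinitePresentation R A := by
  obtain ⟨n, m, P, -⟩ := h
  exact P.finitePresentation_of_isFinite

/-- A strictly standard element lives in a finitely presented algebra. [folklore] -/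
theorem IsStrictlyStandard.finitePresentation {a : A} (h : IsStrictlyStandard R a) :
    Algebra.FinitePresentation R A := by
  obtain ⟨n, m, P, -⟩ := h
  exact P.finitePresentation_of_isFinite

end Definitions

end Literature.AlgebraicGeometry.Resolution

end
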